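import Mathlib
import HarnessLib
import Summits.Schanuel.Schanuel.Theses.TwistedConjugacy
import Literature.NumberTheory.Transcendental.KirbyWeakSchanuelAx
import Literature.Barriers.Schanuel.AxSchanuelFunctionalNotNumerical

/-!
# Birth skeleton (BC3) — crux `TwistedConjugacy.RelSchanuelOverTowerPi` (stmt-Schanuel-17223)

Route `route-Schanuel-TwistedConjugacy` ("exp is wildly conjugate to exp∘μ" + Schanuel relative to
`E(2πi)`), crux #3 SCHANUEL RELATIVE TO THE FULL-KERNEL TOWER: with `E ⊂ ℂ` the KERNEL-FREE TOWER — the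
smallest intermediate field of `ℂ/ℚ` containing `ℚ̄ = algebraicClosure ℚ ℂ` and closed under `exp`, inlined
everywhere as `sInf {K : IntermediateField ℚ ℂ | algebraicClosure ℚ ℂ ≤ K ∧ ∀ w ∈ K, cexp w ∈ K}` — for
`z₁,…,zₙ ∈ ℂ` `ℚ`-linearly independent MODULO `E + ℚ·2πi` (no rational combination `∑ qᵢ zᵢ + r·2πi` with
`q ≠ 0` lies in `E`), `trdeg_{E(2πi)} E(2πi)(z₁,…,zₙ,e^{z₁},…,e^{zₙ}) ≥ n`.

DICTIONARY (Kirby, *Finitely presented exponential fields*, Def. 2.1–2.2, read p. 5 of arXiv:0912.4019):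
let `F₀` be the PARTIAL E-subfield of `ℂ_exp` with exponential domain `D(F₀) = E + ℚ·2πi` (a `ℚ`-subspace
containing `ker exp = 2πiℤ`; `exp(D(F₀)) = exp(E)·μ_∞ ⊆ E`) and underlying field
`ℚ(D(F₀) ∪ exp D(F₀)) = E(2πi)`. Kirby's relative predimension is
`δ(z/D(F₀)) = td(z, eᶻ / D(F₀), exp D(F₀)) − ldim_ℚ(z/D(F₀)) = trdeg_{E(2πi)} E(2πi)(z, eᶻ) − dim_ℚ (span z + D(F₀))/D(F₀)`,
so the crux is LITERALLY `F₀ ◁ ℂ_exp` (Def. 2.2: `δ(z/D(F₀)) ≥ 0` for every tuple `z` from `ℂ`, reduced to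
tuples independent modulo `D(F₀)` by the addition property): THE FULL-KERNEL TOWER IS STRONGLY EMBEDDED IN
`ℂ_exp`. (The sister crux `CyclotomicRigidity.TowerStrong` is `E ◁ ℂ_exp` for the TOTAL kernel-free
E-field `E`; see "Relation to TowerStrong" below.)

This file is the route-level BIRTH CERTIFICATE skeleton of the crux (LENSES-v3 §2 BC3; registrar seat
`planner-skel-stmt-Schanuel-17223-0`, 2026-08-17, route re-audit bin REPAIRABLE): two NAMED stubs and a
kernel-checked composition concluding the crux BY NAME.

## The seam: NUMERICAL CORE inside `ecl(∅)` × TRANSITIVITY OF `◁` MODULO A SUBSPACE (+ Kirby's theorem, PROVED)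

Two facts of the theory of exponential fields cut the crux:

1. (Kirby 2010 EAEF, Thm. 1.2 at `C = ecl ∅`; PROVED in the tree from Ax's theorem via Rosenlicht:
   `Literature.NumberTheory.Transcendental.kirby_relative_schanuel_complex_holds`) the exponential-algebraic
   closure `ecl(∅) ⊂ ℂ` — the countable E-subfield of coordinates of non-degenerate solutions of Khovanskii
   systems over `ℤ`, containing `ℚ̄`, `e`, `π`, `log α`, … — is STRONG in `ℂ_exp`: `ecl(∅) ◁ ℂ`.
2. (Kirby 2013 FPEF, Lemma 2.3, 4th item: "if `F₁ ◁ F₂` and `F₂ ◁ F₃` then `F₁ ◁ F₃`", for PARTIAL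
   E-fields) composites of strong extensions are strong — here for `F₀ ≤ ℚ(ecl ∅) ≤ ℂ_exp` with the
   linear dimension over `F₀` counted modulo its domain `W = E + ℚ·2πi`.

Since `E(2πi) ≤ ℚ(ecl ∅)` (`towerEPi_le_eclField`: `E ≤ ℚ(ecl ∅)` because the latter is one of the
`exp`-closed fields over `ℚ̄` of which `E` is the infimum, and `2πi = πi + πi` with `πi ∈ ecl ∅` a
non-degenerate zero of `eˣ + 1`, tree `Literature.Barriers.Schanuel.pi_mul_I_mem_ecl`), `F₀ ◁ ℂ` follows from
`F₀ ◁ ecl(∅)` alone: every exponentially TRANSCENDENTAL direction of a tuple `z` is discharged by functional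
transcendence (Ax), and what is left is the NUMERICAL CORE over the countable field `ecl(∅)`. The skeleton is
exactly this:

* `stub_coreInEcl` — THE NUMERICAL CORE `F₀ ◁ ecl(∅)` (load-bearing, OPEN): for `z : Fin n → ℂ` with every
  `zᵢ ∈ ecl ∅` and `z` `ℚ`-independent modulo `E + ℚ·2πi`, `n ≤ trdeg_{E(2πi)} E(2πi)(z, eᶻ)` — the crux with
  its quantifier cut down to exponentially algebraic tuples, all other symbols verbatim. NOT the crux
  reworded: the crux gives it by restriction (`stub_coreInEcl_of_rel`, one line), but it gives the crux back
  only THROUGH stub 2 and Kirby's theorem (BC3 probes below: no cheap implication). What the cut exposes: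
  every instance is now a statement about a KHOVANSKII POINT — `z` extends to a solution `x ∈ (ecl ∅)^N` of
  an `N × N` exponential-polynomial system over `ℤ` with non-vanishing Jacobian, so the UPPER bound
  `trdeg_ℚ ℚ(x, eˣ) ≤ N` comes for free and the lower bound asked for becomes GENERICITY OF KHOVANSKII POINTS
  OVER THE FULL-KERNEL TOWER; `ecl ∅` is the SMALLEST `ecl`-closed set, so this is the minimal residue the
  method leaves. It still contains the hard named instances (whenever their independence hypothesis holds,
  which is itself open, e.g. `π ∉ E` for `z = (π)`): `e^π` transcendental over `E(π)`, `log 2, log 3`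
  algebraically independent over `E(π)`, `e^{π²}` transcendental over `E(π)`.
* `stub_relStrongTrans` — TRANSITIVITY OF `◁` MODULO A `ℚ`-SUBSPACE THROUGH AN `exp`-CLOSED INTERMEDIATE
  FIELD (PROVABLE, M/L): for intermediate fields `F ≤ K` of `ℂ/ℚ` with `K` closed under `exp` and ANY
  `ℚ`-submodule `W ⊆ ℂ`: if `F` is strong in `K` modulo `W` (tuples FROM `K`, `ℚ`-independent modulo `W`,
  have `trdeg_F F(z,eᶻ) ≥ n`) and `K` is strong in `ℂ` (tuples `ℚ`-independent modulo `K` have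
  `trdeg_K K(x,eˣ) ≥ n`), then `F` is strong in `ℂ` modulo `W`. Proof plan (Kirby's "easy to verify",
  ≈ 200–400 lines of Lean): given `z` independent modulo `W` (hence `ℚ`-independent, `0 ∈ W`), let
  `Λ = span_ℤ z ≅ ℤⁿ` and `Λ_K = Λ ∩ K`, a PURE subgroup (if `m·v ∈ K` then `v ∈ K`), hence a direct summand:
  pick a `ℤ`-basis `(u, w)` of `Λ = Λ_K ⊕ Λ'` (`|u| = k`); `(u, w)` and `z` differ by `GLₙ(ℤ)`, so
  `F(z, eᶻ) = F(u, w, eᵘ, eʷ) =: L`; `u ⊂ K` is independent modulo `W` (a rational relation among the `u`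
  modulo `W` is one among the `z`), `w` is independent modulo `K` (clear denominators: an integral
  combination of `w` in `K` lies in `Λ_K = span_ℤ u`), and with `M := F(u, eᵘ) ≤ K` (as `F ≤ K`, `u ⊂ K`, `K`
  `exp`-closed) and `M ≤ L`:
  `trdeg_F L = trdeg_F M + trdeg_M L ≥ k + trdeg_M M(w, eʷ) ≥ k + trdeg_K K(w, eʷ) ≥ k + (n − k)`
  by the tower law (Mathlib `Algebra.trdeg_add_eq` / `trdeg_add_le`, tree `trdeg_add_le_of_le_subring`),
  strongness of `F` in `K` at `u`, base change `M ≤ K` (a transcendence basis of `K(S)/K` inside `S` stays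
  independent over `M`), and strongness of `K` at `w`. A genuine lemma of the line, not bookkeeping: it is
  where the tower law, the pure-subgroup splitting and the base change live; NO condition on `W` is needed
  (only `0 ∈ W`). Its case `W = F` is the sister skeleton's registered
  `Cruxes/TowerStrong/Lines/birth.lean :: Sig.stub_strongTrans` — ONE proof serves both routes.
* `RelSchanuelOverTowerPi_of : Sig.stub_coreInEcl → Sig.stub_relStrongTrans → RelSchanuelOverTowerPi` — the
  SORRY-FREE composition (axioms `propext`, `Classical.choice`, `Quot.sound`): stub 2 at `F := E(2πi)`,
  `K := ℚ(ecl ∅)`, `W := kerSpan = E + ℚ·2πi` (a `Submodule ℚ ℂ` whose membership is DEFINITIONALLY the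
  route's two-parameter spelling, `mem_kerSpan_iff`/`indepMod_iff`), fed with `towerEPi_le_eclField`,
  `eclField_exp_mem`, stub 1 (through `mem_eclField_iff : a ∈ ℚ(ecl ∅) ↔ a ∈ ecl ∅`), and `strong_eclField`
  = KIRBY'S THEOREM IN THE ROUTE'S SPELLING (`∀ q, ∑ qᵢ xᵢ ∈ K → q = 0` converted to
  `LinearIndependent ℚ (mkQ ∘ x)` modulo `span_ℚ (ecl ∅) ≤ ℚ(ecl ∅)`, then
  `kirby_relative_schanuel_complex_holds`).
* `RelSchanuelOverTowerPi_proof : RelSchanuelOverTowerPi` — the skeleton in its final shape (the crux BY NAME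
  from the two registered stubs; depends on `sorryAx` through the stubs only).

Exactness: given the (provable) stub 2, `RelSchanuelOverTowerPi ↔ stub 1` (`→` restriction, `←` this
file), so stub 1 is not refutable short of `¬ RelSchanuelOverTowerPi`, i.e. (route KILL CRITERIA:
"RelSchanuelOverTowerPi refuted ⇒ Schanuel is false") short of `¬ Schanuel`.

## Relation to `TowerStrong` (route CyclotomicRigidity) — paper remark, not formalised here

The registered birth skeleton of the sister crux (`Cruxes/TowerStrong/Lines/birth.lean`, 2026-08-17) has
numerical core `E ◁ ecl(∅)` and forecasts its next split as (K) "`π` transcendental over `E`" ∧ (S′)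
"`E(2πi)` strong for exponentially algebraic tuples independent modulo `E ⊕ ℚ·2πi`". (S′) IS `stub_coreInEcl`
of this file, verbatim up to spelling: for `z ∈ (ecl ∅)ⁿ` independent modulo `E`, `span_ℚ z ∩ (E + ℚ·2πi)`
has dimension `≤ 1`; if it is `0`, (S′) and base change `E ≤ E(2πi)` give `trdeg_E ≥ n`; if it is spanned
by `u₁ = e₀ + r·2πi` (`r ≠ 0`), then `e^{u₁} ∈ E`, `E(u₁, e^{u₁}) = E(2πi)` has `trdeg_E = 1` by (K), and
(S′) gives the remaining `n − 1` over `E(2πi)`. So the two routes share ONE numerical core inside `ecl(∅)`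
and differ exactly by (K) ⊇ `PiNotInTower` — the precise form of the route header's "strictly weaker than
CyclotomicRigidity's TowerStrong ∧ PiNotInTower", now located inside the countable field `ecl ∅`.

## Disproof used / negatives / barriers

No `Cruxes/RelSchanuelOverTowerPi/Disproof.lean` exists (`ledger crux ls stmt-Schanuel-17223`: no
workfiles, no crux ideas, no cdisprove cycle; dead lines: none — 2026-08-17), so there is no
`_false_without_` obstruction to honour yet. `ledger negatives --problem Schanuel` (2026-08-17): 2 refuted
statements (PolarPhantoms stmt-Schanuel-6844/6846, "`trdeg ℚ(y, α) < n` for all `y, α`"-type), neither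
equal nor trivially equivalent to either stub. Item note (gate, 2026-08-17T02:00:52Z): "signature does not
elaborate standalone in the context of …DiophantineDichotomy…Jensen.lean" — an artefact of that foreign
context, not of the statement: the signature elaborates verbatim in the route file and here (stub 1 and the
composition are stated over it, `import Mathlib`).
Barrier `Literature.Barriers.Schanuel.AxSchanuelFunctionalNotNumerical` (Ax–Schanuel is functional, not
numerical; every E-derivation kills `ecl ∅`; the summit's residue is its restriction to `ecl ∅`): NOT evaded
but SPENT — stub 2 + Kirby cash in everything the functional method gives for the RELATIVE statement
`F₀ ◁ ℂ`, and stub 1 is, by construction, inside the barrier's residue (tuples from `ecl ∅`), where no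
derivation argument can help; it is the full-kernel-tower analogue of Kirby's Prop. 7.2 / the tree's
`schanuelConjecture_iff_ecl_empty_holds` (used at SUMMIT level by route EclCore), here at crux level and
strictly inside the summit's residue. Barrier `AlgebraicIndependenceOfLogarithms`: applies to stub 1
(`z = (log 2, log 3)`, both in `ecl ∅`) exactly as to the crux — honest: it does; the route's own engine
(TwistedSymmetry) removes only INHOMOGENEOUS log relations, and this skeleton only localises where the
remaining difficulty sits. `AxiomsDoNotForceSchanuel` / `SchanuelPropertyNotFirstOrder`: not triggered (no
transfer from axioms, one structure `ℂ_exp`).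

## Foreseen next split of stub 1 (NOT registered: no decomposition below a crux until something closes)

DEPTH ALONG KHOVANSKII DIMENSION: `stub_coreInEcl ⟸ ∀ N, Core_N` with `Core_N` the statement for tuples
`z` whose coordinates lie in `ecl`-points of systems of size `≤ N` (`N = 1`: `z` among `πi·ℚ`, `log α`,
Lambert-type points `x e^x ∈ ℚ̄`, … — already containing `e^π ∉ E(π)^{alg}`); or KERNEL WEIGHT: the
`σ`-weight bookkeeping of the route's TwistedSymmetry (homogeneous relations over `E(2πi)` first). Recorded
for the lead prover / tenure planner only.

## BC3 audit (this seat; raw outputs under `birth-certificate:` in the seat's NOTES.md and `Lines/birth-probes.md`)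

`lean check --json` rc 0 with `sorry` exactly in `stub_coreInEcl`, `stub_relStrongTrans` (sorry count 2 =
stub count, zero elsewhere); `#print axioms RelSchanuelOverTowerPi_of` = [propext, Classical.choice,
Quot.sound]. Probes, for `X ∈ {Sig.stub_coreInEcl, Sig.stub_relStrongTrans}` and target
`T ∈ {RelSchanuelOverTowerPi, Schanuel}`: `example : X → T` by the payload battery
`first | exact? | simpa | aesop`, by the BC2 battery `first | exact? | simpa [X] | (unfold X; simpa) | aesop`,
`(h : X)` by `first | exact? | simpa using h | aesop`, and — because a heartbeat timeout inside `exact?`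
aborts a `first` block — every disjunct SEPARATELY (`exact?`, `simpa [X]`, `unfold X T; simpa`, `aesop`,
`unfold X T; aesop`), all under `maxHeartbeats 400000`; plus dedup `example : X` by `exact?` / `unfold X; aesop`.
Result: see `Lines/birth-probes.md` — every probe of groups (a)–(c) FAILS for both stubs.

## References

* J. Kirby, *Exponential algebraicity in exponential fields*, Bull. LMS 42 (2010) 879–890, arXiv:0810.4285:
  Thm. 1.2, Lemma 3.3, Remark 3.4, §7, Prop. 7.2. [Kirby2010]
* J. Kirby, *Finitely presented exponential fields*, Algebra & Number Theory 7 (2013) 943–980,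
  doi:10.2140/ant.2013.7.943, arXiv:0912.4019: Def. 2.1 (partial E-fields, `D(F)`), Def. 2.2 (strong
  extensions `F ◁ F₁`, predimension relative to `D(F)`), Lemma 2.3 (4th item). [Kirby2013FPEF]
* J. Ax, *On Schanuel's conjectures*, Ann. of Math. 93 (1971) 252–268, Thm. 3. [Ax1971]
* M. Waldschmidt, *Diophantine approximation on linear algebraic groups* (2000), Conj. 1.14. [Waldschmidt2000]
* Route file `Summits/Schanuel/Schanuel/Theses/TwistedConjugacy.lean` (crux #3, `Assembly`, `closes`); sister
  skeleton `Summits/Schanuel/Schanuel/Cruxes/TowerStrong/Lines/birth.lean`; barrier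
  `Literature/Barriers/Schanuel/AxSchanuelFunctionalNotNumerical.lean`.
-/

set_option linter.dupNamespace false

noncomputable section

namespace Summit.Schanuel.Schanuel.Cruxes.RelSchanuelOverTowerPi.Birth

open Summit.Schanuel.Schanuel.Theses.TwistedConjugacy
open Literature.NumberTheory.Transcendental

/-! ### Vocabulary (proof-side abbreviations; the stub statements below are written out literally) -/

/-- The kernel-free tower `E` — verbatim the route's inlined expression: the smallest intermediate
field of `ℂ/ℚ` containing `ℚ̄ = algebraicClosure ℚ ℂ` and closed under `exp`. -/
abbrev towerE : IntermediateField ℚ ℂ :=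
  sInf {K : IntermediateField ℚ ℂ | algebraicClosure ℚ ℂ ≤ K ∧ ∀ w ∈ K, Complex.exp w ∈ K}

/-- `2πi`, spelled as in the route file. -/
abbrev twoPiI : ℂ := 2 * (Real.pi : ℂ) * Complex.I

/-- The crux's base field `E(2πi) = ℚ(E ∪ {2πi})`, spelled as in the route file. -/
abbrev towerEPi : IntermediateField ℚ ℂ :=
  IntermediateField.adjoin ℚ (((towerE : IntermediateField ℚ ℂ) : Set ℂ) ∪ {twoPiI})

/-- The field `ℚ(ecl ∅)` generated by Kirby's exponential-algebraic closure of `∅` in `ℂ_exp` (as a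
set it IS `ecl ∅`, `mem_eclField_iff`); the base field of the tree's PROVED relative Schanuel
theorem `kirby_relative_schanuel_complex_holds` (Kirby 2010, Thm. 1.2 at `C = ecl ∅`). -/
abbrev eclField : IntermediateField ℚ ℂ :=
  IntermediateField.adjoin ℚ (ecl (∅ : Set ℂ))

/-- The KERNEL-CORRECTED subspace `E + ℚ·2πi ⊂ ℂ` as a `ℚ`-submodule: `x ∈ E + ℚ·2πi` iff
`x + r·2πi ∈ E` for some rational `r` (membership is definitionally the route's spelling). -/
def kerSpan : Submodule ℚ ℂ where
  carrier := {x : ℂ | ∃ r : ℚ, x + (r : ℂ) * (2 * (Real.pi : ℂ) * Complex.I) ∈ towerE}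
  zero_mem' := ⟨0, by simp⟩
  add_mem' := by
    rintro x y ⟨r, hr⟩ ⟨s, hs⟩
    refine ⟨r + s, ?_⟩
    have h := (towerE).add_mem hr hs
    convert h using 1
    push_cast
    ring
  smul_mem' := by
    rintro c x ⟨r, hr⟩
    refine ⟨c * r, ?_⟩
    have hc : ((c : ℚ) : ℂ) ∈ towerE := SubfieldClass.ratCast_mem towerE c
    have h := (towerE).mul_mem hc hr
    convert h using 1
    rw [Rat.smul_def]
    push_cast
    ring

theorem mem_kerSpan_iff {x : ℂ} :
    x ∈ kerSpan ↔ ∃ r : ℚ, x + (r : ℂ) * (2 * (Real.pi : ℂ) * Complex.I) ∈ towerE :=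
  Iff.rfl

/-! ### Stub signatures (`Sig.stub_*`; the hypothesis heads of `RelSchanuelOverTowerPi_of` carry the
registered stub names) -/

/-- STUB 1 — THE NUMERICAL CORE: `E(2πi)` IS STRONG, MODULO THE KERNEL, INSIDE THE
EXPONENTIAL-ALGEBRAIC CLOSURE. For `z₁,…,zₙ` EXPONENTIALLY ALGEBRAIC (each `zᵢ ∈ ecl ∅`: a coordinate
of a non-degenerate solution of a Khovanskii system over `ℤ`) and `ℚ`-linearly independent modulo
`E + ℚ·2πi`, `trdeg_{E(2πi)} E(2πi)(z, e^z) ≥ n`. The crux with its quantifier `z : Fin n → ℂ` cut down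
to the COUNTABLE E-field `ecl ∅ ⊇ E ∪ {π}`; implied by the crux (restriction), gives it back only through
STUB 2 and Kirby's theorem. OPEN (contains: `e^π` transcendental over `E(π)`, `log 2, log 3`
algebraically independent over `E(π)`). -/
def Sig.stub_coreInEcl : Prop :=
  ∀ (n : ℕ) (z : Fin n → ℂ), (∀ i, z i ∈ ecl (∅ : Set ℂ)) →
    (∀ (q : Fin n → ℚ) (r : ℚ), (∑ i, (q i : ℂ) * z i) + (r : ℂ) * (2 * (Real.pi : ℂ) * Complex.I) ∈
        (sInf {K : IntermediateField ℚ ℂ | algebraicClosure ℚ ℂ ≤ K ∧ ∀ w ∈ K, Complex.exp w ∈ K} :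
          IntermediateField ℚ ℂ) → q = 0) →
      (n : Cardinal) ≤ Algebra.trdeg
        ↥(IntermediateField.adjoin ℚ
            (((sInf {K : IntermediateField ℚ ℂ | algebraicClosure ℚ ℂ ≤ K ∧ ∀ w ∈ K, Complex.exp w ∈ K} :
                IntermediateField ℚ ℂ) : Set ℂ) ∪ {2 * (Real.pi : ℂ) * Complex.I}))
        ↥(IntermediateField.adjoin
            ↥(IntermediateField.adjoin ℚ
                (((sInf {K : IntermediateField ℚ ℂ | algebraicClosure ℚ ℂ ≤ K ∧ ∀ w ∈ K, Complex.exp w ∈ K} :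
                    IntermediateField ℚ ℂ) : Set ℂ) ∪ {2 * (Real.pi : ℂ) * Complex.I}))
            (Set.range z ∪ Set.range (Complex.exp ∘ z)))

/-- STUB 2 — TRANSITIVITY OF STRONG EMBEDDINGS, MODULO A `ℚ`-SUBSPACE, THROUGH AN `exp`-CLOSED
INTERMEDIATE FIELD (Kirby, *Finitely presented exponential fields*, Lemma 2.3: "if `F₁ ◁ F₂` and
`F₂ ◁ F₃` then `F₁ ◁ F₃`", with `F₃ = ℂ_exp` and the linear dimension counted modulo `W`). For
intermediate fields `F ≤ K` of `ℂ/ℚ` with `K` closed under `exp` and ANY `ℚ`-submodule `W ⊆ ℂ`: if `F` is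
strong in `K` modulo `W` (every tuple FROM `K` that is `ℚ`-independent modulo `W` has
`trdeg_F F(z, e^z) ≥ n`) and `K` is strong in `ℂ` (every tuple `ℚ`-independent modulo `K` has
`trdeg_K K(x, eˣ) ≥ n`), then `F` is strong in `ℂ` modulo `W`. PROVABLE (pure transcendence-degree
algebra, M/L): with `Λ = span_ℤ z` and the pure subgroup `Λ_K = Λ ∩ K`, take a `ℤ`-basis `(u, w)` of
`Λ = Λ_K ⊕ Λ'`; then `F(z, e^z) = F(u, w, e^u, e^w)`, `u ⊂ K` is independent modulo `W`, `w` is independent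
modulo `K`, and `trdeg_F F(z,e^z) = trdeg_F F(u,e^u) + trdeg_{F(u,e^u)} F(z,e^z) ≥ k + trdeg_K K(w,e^w) ≥ n`
(tower law; base change `F(u, e^u) ≤ K` only lowers the transcendence degree). The case `W = F` is the
sister skeleton's `TowerStrong.Birth.Sig.stub_strongTrans`. -/
def Sig.stub_relStrongTrans : Prop :=
  ∀ (F K : IntermediateField ℚ ℂ) (W : Submodule ℚ ℂ), F ≤ K → (∀ w ∈ K, Complex.exp w ∈ K) →
    (∀ (n : ℕ) (z : Fin n → ℂ), (∀ i, z i ∈ K) →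
        (∀ q : Fin n → ℚ, (∑ i, (q i : ℂ) * z i) ∈ W → q = 0) →
          (n : Cardinal) ≤ Algebra.trdeg ↥F
            ↥(IntermediateField.adjoin ↥F (Set.range z ∪ Set.range (Complex.exp ∘ z)))) →
    (∀ (n : ℕ) (x : Fin n → ℂ),
        (∀ q : Fin n → ℚ, (∑ i, (q i : ℂ) * x i) ∈ K → q = 0) →
          (n : Cardinal) ≤ Algebra.trdeg ↥K
            ↥(IntermediateField.adjoin ↥K (Set.range x ∪ Set.range (Complex.exp ∘ x)))) →
    ∀ (n : ℕ) (z : Fin n → ℂ),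
      (∀ q : Fin n → ℚ, (∑ i, (q i : ℂ) * z i) ∈ W → q = 0) →
        (n : Cardinal) ≤ Algebra.trdeg ↥F
          ↥(IntermediateField.adjoin ↥F (Set.range z ∪ Set.range (Complex.exp ∘ z)))

/-! ### Registered stubs -/

/-- Registered stub 1 — the numerical core: `E(2πi)` strong modulo `E + ℚ·2πi` inside `ecl(∅)`
(load-bearing, OPEN). -/
theorem stub_coreInEcl : Sig.stub_coreInEcl := by
  sorry

/-- Registered stub 2 — transitivity of strong embeddings modulo a `ℚ`-subspace through an
`exp`-closed intermediate field (PROVABLE, M/L; Kirby FPEF Lemma 2.3). -/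
theorem stub_relStrongTrans : Sig.stub_relStrongTrans := by
  sorry

/-! ### Glue: the exponential-algebraic closure as an intermediate field, the kernel-corrected
independence, and Kirby's theorem in the route's spelling (sorry-free) -/

/-- `ℚ(ecl ∅) = ecl ∅` as sets: `ecl ∅` is an `ecl`-closed subfield containing `ℚ`
(`adjoin_rat_le_of_isEclClosed`, `isEclClosed_ecl`). [cite: Kirby2010, Lemma 3.3] -/
theorem mem_eclField_iff {a : ℂ} : a ∈ eclField ↔ a ∈ ecl (∅ : Set ℂ) :=
  ⟨fun h => adjoin_rat_le_of_isEclClosed (isEclClosed_ecl (∅ : Set ℂ)) h,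
   fun h => IntermediateField.subset_adjoin ℚ (ecl (∅ : Set ℂ)) h⟩

/-- `ℚ(ecl ∅)` is closed under `exp` (Kirby Lemma 3.3, tree `Khovanskii.exp_mem_ecl`).
[cite: Kirby2010, Lemma 3.3] -/
theorem eclField_exp_mem : ∀ w ∈ eclField, Complex.exp w ∈ eclField := fun _ hw =>
  mem_eclField_iff.mpr (Khovanskii.exp_mem_ecl (mem_eclField_iff.mp hw))

/-- `ℚ̄ ≤ ℚ(ecl ∅)`: algebraic numbers are exponentially algebraic (Kirby §7; tree
`Literature.Barriers.Schanuel.mem_ecl_of_isAlgebraic`). [cite: Kirby2010, §7] -/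
theorem algebraicClosure_le_eclField : algebraicClosure ℚ ℂ ≤ eclField := fun _ hx =>
  mem_eclField_iff.mpr
    (Literature.Barriers.Schanuel.mem_ecl_of_isAlgebraic (∅ : Set ℂ) ((mem_algebraicClosure_iff).mp hx))

/-- The kernel-free tower lies inside the exponential-algebraic closure: `E ≤ ℚ(ecl ∅)` (the latter
is one of the `exp`-closed fields over `ℚ̄` whose infimum `E` is). [folklore] -/
theorem towerE_le_eclField : towerE ≤ eclField :=
  sInf_le ⟨algebraicClosure_le_eclField, eclField_exp_mem⟩

/-- `2πi ∈ ℚ(ecl ∅)`: `πi ∈ ecl ∅` (it solves `eˣ + 1 = 0` non-degenerately; tree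
`Literature.Barriers.Schanuel.pi_mul_I_mem_ecl`) and `2πi = πi + πi`. [cite: Kirby2010, Remark 3.4] -/
theorem twoPiI_mem_eclField : (2 * (Real.pi : ℂ) * Complex.I) ∈ eclField := by
  have h : (Real.pi * Complex.I : ℂ) ∈ eclField :=
    mem_eclField_iff.mpr (Literature.Barriers.Schanuel.pi_mul_I_mem_ecl ∅)
  have h2 := add_mem h h
  convert h2 using 1
  ring

/-- The crux's base field lies inside the exponential-algebraic closure: `E(2πi) ≤ ℚ(ecl ∅)`. [folklore] -/
theorem towerEPi_le_eclField : towerEPi ≤ eclField := by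
  rw [IntermediateField.adjoin_le_iff]
  exact Set.union_subset (fun x hx => towerE_le_eclField hx)
    (Set.singleton_subset_iff.mpr twoPiI_mem_eclField)

/-- The route's spelling of "`z` is `ℚ`-linearly independent modulo `E + ℚ·2πi`" (two rational
parameters `q, r`) is independence modulo the submodule `kerSpan`. [folklore] -/
theorem indepMod_iff (n : ℕ) (z : Fin n → ℂ) :
    (∀ (q : Fin n → ℚ) (r : ℚ),
        (∑ i, (q i : ℂ) * z i) + (r : ℂ) * (2 * (Real.pi : ℂ) * Complex.I) ∈ towerE → q = 0) ↔
      (∀ q : Fin n → ℚ, (∑ i, (q i : ℂ) * z i) ∈ kerSpan → q = 0) :=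
  ⟨fun H q hq => by
      obtain ⟨r, hr⟩ := (mem_kerSpan_iff).mp hq
      exact H q r hr,
   fun H q r hr => H q ((mem_kerSpan_iff).mpr ⟨r, hr⟩)⟩

/-- **Kirby 2010 Thm. 1.2 in the route's spelling**: `ℚ(ecl ∅)` is STRONG in `ℂ_exp` — for
`x : Fin n → ℂ` with no non-trivial rational combination in `ℚ(ecl ∅)`,
`n ≤ trdeg_{ℚ(ecl ∅)} ℚ(ecl ∅)(x, eˣ)`. From the tree's PROVED `kirby_relative_schanuel_complex_holds`
(Ax's theorem via Rosenlicht), converting "`∀ q, ∑ qᵢ xᵢ ∈ K → q = 0`" into linear independence of `x`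
modulo `span_ℚ (ecl ∅)`. [cite: Kirby2010, Thm. 1.2] -/
theorem strong_eclField (n : ℕ) (x : Fin n → ℂ)
    (hx : ∀ q : Fin n → ℚ, (∑ i, (q i : ℂ) * x i) ∈ eclField → q = 0) :
    (n : Cardinal) ≤ Algebra.trdeg ↥eclField
      ↥(IntermediateField.adjoin ↥eclField (Set.range x ∪ Set.range (Complex.exp ∘ x))) := by
  refine kirby_relative_schanuel_complex_holds n x ?_
  rw [Fintype.linearIndependent_iff]
  intro g hg
  have h1 : (Submodule.span ℚ (ecl (∅ : Set ℂ))).mkQ (∑ i, (g i : ℂ) * x i) = 0 := by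
    rw [map_sum]
    refine Eq.trans (Finset.sum_congr rfl fun i _ => ?_) hg
    rw [Function.comp_apply, ← map_smul]
    exact congrArg _ (Rat.smul_def (g i) (x i)).symm
  rw [Submodule.mkQ_apply, Submodule.Quotient.mk_eq_zero] at h1
  have hle : Submodule.span ℚ (ecl (∅ : Set ℂ)) ≤ Subalgebra.toSubmodule eclField.toSubalgebra :=
    Submodule.span_le.mpr fun a ha => IntermediateField.subset_adjoin ℚ (ecl (∅ : Set ℂ)) ha
  have h2 : (∑ i, (g i : ℂ) * x i) ∈ eclField := hle h1
  exact fun i => congrFun (hx g h2) i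

/-! ### Composition -/

/-- **THE SKELETON THEOREM.** The crux `Summit.Schanuel.Schanuel.Theses.TwistedConjugacy.RelSchanuelOverTowerPi`
(`E(2πi)` strong in `ℂ_exp` modulo `E + ℚ·2πi`), concluded BY NAME from the two declared stubs:
transitivity modulo `W := E + ℚ·2πi` (stub 2) applied to `E(2πi) ≤ ℚ(ecl ∅) ≤ ℂ`, with
"`E(2πi)` strong in `ℚ(ecl ∅)` modulo `W`" = stub 1 and "`ℚ(ecl ∅)` strong in `ℂ`" = Kirby's theorem
(`strong_eclField`, PROVED in the tree). Sorry-free. [cite: Kirby2010, Thm. 1.2] -/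
theorem RelSchanuelOverTowerPi_of (hcore : Sig.stub_coreInEcl) (htrans : Sig.stub_relStrongTrans) :
    RelSchanuelOverTowerPi := by
  intro n z hz
  exact htrans towerEPi eclField kerSpan towerEPi_le_eclField eclField_exp_mem
    (fun m w hwK hwW => hcore m w (fun i => mem_eclField_iff.mp (hwK i)) ((indepMod_iff m w).mpr hwW))
    strong_eclField n z ((indepMod_iff n z).mp hz)

/-- The skeleton in its final shape: the crux BY NAME from the two registered stubs (depends on
`sorryAx` through the stubs only). -/
theorem RelSchanuelOverTowerPi_proof : RelSchanuelOverTowerPi :=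
  RelSchanuelOverTowerPi_of stub_coreInEcl stub_relStrongTrans

/-! ### Sanity: the crux gives stub 1 back (restriction), so stub 1 is not refutable short of
`¬ RelSchanuelOverTowerPi`, i.e. (route KILL CRITERIA) short of `¬ Schanuel`. -/

/-- `RelSchanuelOverTowerPi → stub 1` (restriction of the quantifier). [folklore] -/
theorem stub_coreInEcl_of_rel (h : RelSchanuelOverTowerPi) : Sig.stub_coreInEcl :=
  fun n z _ hz => h n z hz

end Summit.Schanuel.Schanuel.Cruxes.RelSchanuelOverTowerPi.Birth

end
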